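import Mathlib
import Literature.Analysis.FluidPDE.MollifiedEulerCone
import Literature.Analysis.FluidPDE.WeaklyDivFreeRemovablePoint
import HarnessLib

/-!
# Translation-mollified weak Euler cones on `ℝ³`: coordinates, smoothness, divergence, defect

Analysis/FluidPDE support file, the `ℝ³`-coordinate companion of `MollifiedEulerCone` (tool T1 of
the free-space sink completion, route PointSink of the anomalous-dissipation summit). For
`V : ℝ³ → ℝ³` measurable with `|V|² ∈ L¹_loc` and a continuous kernel `ρ` supported in `B_δ`, the
mollified velocity `V_ρ = ρ ⋆ V` and flux `(S_ρ)ᵢⱼ(x) = ∫ ρ(a) Vᵢ(x − a) Vⱼ(x − a) da` satisfy: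

* `integral_sum_sum_mollifiedFlux_mul_eq_zero` — if `V` is pressure-free weak Euler off the
  origin, `∫ ∑ᵢⱼ (S_ρ)ᵢⱼ (Dφ eⱼ)ᵢ = 0` for every smooth divergence-free `φ ∈ C_c^∞({δ < ‖x‖})`
  (the coordinate form of `MollifiedEulerCone.integral_integral_mul_inner_translate_eq_zero`, in
  the stress-pairing format `∑ i, ∑ j, R x i j * fderiv ℝ w x (EuclideanSpace.single j 1) i` of the
  summit's Euler–Reynolds clauses);
* `contDiff_convolution_velocity`, `contDiff_convolution_flux` — `V_ρ`, `S_ρ ∈ C^∞` for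
  `ρ ∈ C_c^∞`;
* `divergence_convolution_velocity_eq_zero` — `div V_ρ = 0` if `V` is weakly divergence free off
  the origin (removable point, `isWeaklyDivFree_of_puncture`);
* `posSemidef_mollified_defect` — for a probability kernel the pointwise defect
  `S_ρ(x) − V_ρ(x) ⊗ V_ρ(x)` is positive semidefinite (covariance of `a ↦ V(x − a)` under
  `ρ(a) da`, `MollifiedEulerCone.posSemidef_covariance`): the mollified pair is a smooth
  Euler–Reynolds SUBsolution off `B̄_δ`;
* the integrability/unfolding kit `integrable_mul_normSq_translate`,
  `integrable_mul_apply_mul_apply_translate`, `integrable_mul_apply_translate`,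
  `sum_sum_mul_mul_apply_single`, `sum_sum_integral_mul_eq_integral_inner`,
  `convolution_velocity_apply(_coord)`, `convolution_flux_apply`.

## Mathlib / tree search

As in `MollifiedEulerCone`; additionally Mathlib's `EuclideanSpace.basisFun`, `PiLp.inner_apply`,
`PiLp.norm_apply_le`, `ContinuousLinearMap.integral_comp_comm`,
`integrable_withDensity_iff_integrable_smul'`, `integral_withDensity_eq_integral_toReal_smul`.
No definitions, no named facts, no duplicates (searched 2026-08-17).

## References

* C. De Lellis, L. Székelyhidi Jr., Arch. Ration. Mech. Anal. 195 (2010) 225–260, §2.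
* P. Constantin, W. E, E. S. Titi, Comm. Math. Phys. 165 (1994) 207–209.
-/

noncomputable section

open MeasureTheory Filter Topology Set Metric Function ContinuousLinearMap
open scoped RealInnerProductSpace ContDiff Convolution Pointwise

namespace Literature.Analysis.FluidPDE

namespace MollifiedEulerCone

/-! ### Coordinates on `ℝ³`: the mollified velocity `ρ ⋆ V` and stress `ρ ⋆ (V ⊗ V)` -/

section Euclidean

/-- The quadratic pairing in coordinates: `∑ᵢⱼ vᵢ vⱼ (L eⱼ)ᵢ = ⟪v, L v⟫`. [folklore] -/
theorem sum_sum_mul_mul_apply_single (v : EuclideanSpace ℝ (Fin 3)) (L : EuclideanSpace ℝ (Fin 3) →L[ℝ] EuclideanSpace ℝ (Fin 3)) :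
    ∑ i, ∑ j, v i * v j * L (EuclideanSpace.single j 1) i = ⟪v, L v⟫ := by
  have hv : L v = ∑ j, v j • L (EuclideanSpace.single j 1) := by
    conv_lhs => rw [← (EuclideanSpace.basisFun (Fin 3) ℝ).sum_repr v]
    simp only [map_sum, map_smul, EuclideanSpace.basisFun_repr, EuclideanSpace.basisFun_apply]
  rw [hv, inner_sum, Finset.sum_comm]
  refine Finset.sum_congr rfl fun j _ => ?_
  rw [inner_smul_right, PiLp.inner_apply, Finset.mul_sum]
  refine Finset.sum_congr rfl fun i _ => ?_
  simp only [RCLike.inner_apply, conj_trivial]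
  ring

variable {V : EuclideanSpace ℝ (Fin 3) → EuclideanSpace ℝ (Fin 3)} {ρ : EuclideanSpace ℝ (Fin 3) → ℝ}

/-- `a ↦ ρ(a) |V(x − a)|²` is integrable for `ρ ∈ C_c`, `|V|² ∈ L¹_loc`. [folklore] -/
theorem integrable_mul_normSq_translate (hV2 : LocallyIntegrable (fun x => ‖V x‖ ^ 2) volume)
    (hρ : Continuous ρ) (hρc : HasCompactSupport ρ) (x : EuclideanSpace ℝ (Fin 3)) :
    Integrable (fun a => ρ a * ‖V (x - a)‖ ^ 2) := by
  have h := hρc.convolutionExists_left (lsmul ℝ ℝ) hρ hV2 x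
  simpa [ConvolutionExistsAt, lsmul_apply] using h

/-- `a ↦ V(x − a)` is a.e.-strongly measurable. [folklore] -/
theorem aestronglyMeasurable_translate (hVm : AEStronglyMeasurable V volume) (x : EuclideanSpace ℝ (Fin 3)) :
    AEStronglyMeasurable (fun a => V (x - a)) volume :=
  hVm.comp_quasiMeasurePreserving
    (Measure.measurePreserving_sub_left volume x).quasiMeasurePreserving

/-- `a ↦ ρ(a) Vᵢ(x − a) Vⱼ(x − a)` is integrable for `ρ ∈ C_c`, `|V|² ∈ L¹_loc`
(`|VᵢVⱼ| ≤ |V|²`). [folklore] -/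
theorem integrable_mul_apply_mul_apply_translate (hVm : AEStronglyMeasurable V volume)
    (hV2 : LocallyIntegrable (fun x => ‖V x‖ ^ 2) volume) (hρ : Continuous ρ)
    (hρc : HasCompactSupport ρ) (x : EuclideanSpace ℝ (Fin 3)) (i j : Fin 3) :
    Integrable (fun a => ρ a * (V (x - a) i * V (x - a) j)) := by
  have hm := aestronglyMeasurable_translate hVm x
  have hmi : ∀ k, AEStronglyMeasurable (fun a => V (x - a) k) volume := fun k =>
    (EuclideanSpace.proj k : EuclideanSpace ℝ (Fin 3) →L[ℝ] ℝ).continuous.comp_aestronglyMeasurable hm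
  refine (integrable_mul_normSq_translate hV2 hρ hρc x).mono
    (hρ.aestronglyMeasurable.mul ((hmi i).mul (hmi j))) (Eventually.of_forall fun a => ?_)
  rw [norm_mul, norm_mul, norm_mul, Real.norm_of_nonneg (sq_nonneg _), sq]
  gcongr
  · exact PiLp.norm_apply_le _ _
  · exact PiLp.norm_apply_le _ _

/-- `a ↦ ρ(a) Vᵢ(x − a)` is integrable for `ρ ∈ C_c`, `|V|² ∈ L¹_loc` (`|Vᵢ| ≤ (1 + |V|²)/2`).
[folklore] -/
theorem integrable_mul_apply_translate (hVm : AEStronglyMeasurable V volume)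
    (hV2 : LocallyIntegrable (fun x => ‖V x‖ ^ 2) volume) (hρ : Continuous ρ)
    (hρc : HasCompactSupport ρ) (x : EuclideanSpace ℝ (Fin 3)) (i : Fin 3) :
    Integrable (fun a => ρ a * V (x - a) i) := by
  have hm := aestronglyMeasurable_translate hVm x
  have hmi : AEStronglyMeasurable (fun a => V (x - a) i) volume :=
    (EuclideanSpace.proj i : EuclideanSpace ℝ (Fin 3) →L[ℝ] ℝ).continuous.comp_aestronglyMeasurable hm
  have h1 : Integrable (fun a => ‖ρ a‖ * 1 + ‖ρ a‖ * ‖V (x - a)‖ ^ 2) := by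
    refine ((hρ.integrable_of_hasCompactSupport hρc).norm.mul_const 1).add ?_
    exact (integrable_mul_normSq_translate hV2 hρ hρc x).norm.congr
      (Eventually.of_forall fun a => by
        simp only [norm_mul, Real.norm_of_nonneg (sq_nonneg _)])
  refine h1.mono (hρ.aestronglyMeasurable.mul hmi) (Eventually.of_forall fun a => ?_)
  have hR : 0 ≤ ‖ρ a‖ * 1 + ‖ρ a‖ * ‖V (x - a)‖ ^ 2 := by positivity
  rw [norm_mul, Real.norm_of_nonneg hR, ← mul_add]
  refine mul_le_mul_of_nonneg_left ?_ (norm_nonneg _)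
  have h := PiLp.norm_apply_le (V (x - a)) i
  nlinarith [sq_nonneg (‖V (x - a)‖ - 1), norm_nonneg (V (x - a) i)]

/-- The mollified stress paired with a matrix in coordinates:
`∑ᵢⱼ (∫ ρ(a) Vᵢ(x−a)Vⱼ(x−a) da) (L eⱼ)ᵢ = ∫ ρ(a) ⟪V(x−a), L V(x−a)⟫ da`. [folklore] -/
theorem sum_sum_integral_mul_eq_integral_inner {x : EuclideanSpace ℝ (Fin 3)}
    (hint : ∀ i j, Integrable (fun a => ρ a * (V (x - a) i * V (x - a) j))) (L : EuclideanSpace ℝ (Fin 3) →L[ℝ] EuclideanSpace ℝ (Fin 3)) :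
    ∑ i, ∑ j, (∫ a, ρ a * (V (x - a) i * V (x - a) j)) * L (EuclideanSpace.single j 1) i =
      ∫ a, ρ a * ⟪V (x - a), L (V (x - a))⟫ := by
  have hterm : ∀ a, ρ a * ⟪V (x - a), L (V (x - a))⟫ =
      ∑ i, ∑ j, ρ a * (V (x - a) i * V (x - a) j) * L (EuclideanSpace.single j 1) i := by
    intro a
    rw [← sum_sum_mul_mul_apply_single, Finset.mul_sum]
    refine Finset.sum_congr rfl fun i _ => ?_
    rw [Finset.mul_sum]
    refine Finset.sum_congr rfl fun j _ => ?_
    ring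
  simp_rw [hterm]
  rw [integral_finsetSum _ fun i _ => ?_]
  · refine Finset.sum_congr rfl fun i _ => ?_
    rw [integral_finsetSum _ fun j _ => (hint i j).mul_const _]
    refine Finset.sum_congr rfl fun j _ => ?_
    rw [integral_mul_const]
  · exact integrable_finsetSum _ fun j _ => (hint i j).mul_const _

/-- **The mollified momentum flux is an exact linear subsolution off the ball (coordinates).**
Let `V : ℝ³ → ℝ³` be measurable, `|V|² ∈ L¹_loc(ℝ³)`, pressure-free weak Euler off the origin,
`ρ ∈ C(ℝ³)` with `support ρ ⊆ B_δ`, and `Sᵢⱼ(x) = ∫ ρ(a) Vᵢ(x − a) Vⱼ(x − a) da` the mollified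
flux `ρ ⋆ (V ⊗ V)`. Then `∫ ∑ᵢⱼ Sᵢⱼ ∂ⱼφᵢ = 0` for every smooth divergence-free `φ` compactly
supported in `{δ < ‖x‖}` (`(∂ⱼφ)ᵢ = (Dφ eⱼ)ᵢ`, the stress pairing of the summit's Euler–Reynolds
clauses). [folklore] -/
theorem integral_sum_sum_mollifiedFlux_mul_eq_zero (hVm : AEStronglyMeasurable V volume)
    (hV2 : LocallyIntegrable (fun x => ‖V x‖ ^ 2) volume)
    (hEuler : ∀ φ : EuclideanSpace ℝ (Fin 3) → EuclideanSpace ℝ (Fin 3), FunctionSpaces.IsTestFunctionOn ⟨{x : EuclideanSpace ℝ (Fin 3) | x ≠ 0}, isOpen_ne⟩ φ →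
      (∀ x, VectorCalculus.divergence φ x = 0) → ∫ x, ⟪V x, fderiv ℝ φ x (V x)⟫ = 0)
    (hρ : Continuous ρ) {δ : ℝ} (hρδ : support ρ ⊆ ball (0 : EuclideanSpace ℝ (Fin 3)) δ) {φ : EuclideanSpace ℝ (Fin 3) → EuclideanSpace ℝ (Fin 3)}
    (hφ : FunctionSpaces.IsTestFunctionOn
      ⟨{x : EuclideanSpace ℝ (Fin 3) | δ < ‖x‖}, isOpen_lt continuous_const continuous_norm⟩ φ)
    (hdiv : ∀ x, VectorCalculus.divergence φ x = 0) :
    ∫ x, ∑ i, ∑ j, (∫ a, ρ a * (V (x - a) i * V (x - a) j)) *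
      fderiv ℝ φ x (EuclideanSpace.single j 1) i = 0 := by
  have hρc : HasCompactSupport ρ := hasCompactSupport_of_support_subset_ball hρδ
  rw [← integral_integral_mul_inner_translate_eq_zero hVm hV2 hEuler hρ hρδ hφ hdiv]
  refine integral_congr_ae (Eventually.of_forall fun x => ?_)
  exact sum_sum_integral_mul_eq_integral_inner
    (fun i j => integrable_mul_apply_mul_apply_translate hVm hV2 hρ hρc x i j) (fderiv ℝ φ x)

/-! ### Smoothness, divergence and the defect of the mollified pair -/

/-- The mollified velocity `ρ ⋆ V` unfolded: `(ρ ⋆ V)(x) = ∫ ρ(a) V(x − a) da`. [folklore] -/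
theorem convolution_velocity_apply (x : EuclideanSpace ℝ (Fin 3)) :
    (ρ ⋆[lsmul ℝ ℝ, volume] V) x = ∫ a, ρ a • V (x - a) := by
  simp only [convolution_def, lsmul_apply]

/-- The mollified flux entry `ρ ⋆ (VᵢVⱼ)` unfolded: `= ∫ ρ(a) Vᵢ(x − a) Vⱼ(x − a) da`. [folklore] -/
theorem convolution_flux_apply (x : EuclideanSpace ℝ (Fin 3)) (i j : Fin 3) :
    (ρ ⋆[lsmul ℝ ℝ, volume] fun y => V y i * V y j) x = ∫ a, ρ a * (V (x - a) i * V (x - a) j) := by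
  simp only [convolution_def, lsmul_apply, smul_eq_mul]

/-- The coordinates of the mollified velocity: `(ρ ⋆ V)(x)ᵢ = ∫ ρ(a) Vᵢ(x − a) da`. [folklore] -/
theorem convolution_velocity_apply_coord (hVm : AEStronglyMeasurable V volume)
    (hV2 : LocallyIntegrable (fun x => ‖V x‖ ^ 2) volume) (hρ : Continuous ρ)
    (hρc : HasCompactSupport ρ) (x : EuclideanSpace ℝ (Fin 3)) (i : Fin 3) :
    (ρ ⋆[lsmul ℝ ℝ, volume] V) x i = ∫ a, ρ a * V (x - a) i := by
  have hint : Integrable (fun a => ρ a • V (x - a)) := by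
    have h := hρc.convolutionExists_left (lsmul ℝ ℝ) hρ (locallyIntegrable_of_normSq hVm hV2) x
    simpa [ConvolutionExistsAt, lsmul_apply] using h
  rw [convolution_velocity_apply]
  have h := ((EuclideanSpace.proj i : EuclideanSpace ℝ (Fin 3) →L[ℝ] ℝ).integral_comp_comm hint).symm
  simpa [smul_eq_mul] using h

/-- `VᵢVⱼ ∈ L¹_loc` when `|V|² ∈ L¹_loc`. [folklore] -/
theorem locallyIntegrable_apply_mul_apply (hVm : AEStronglyMeasurable V volume)
    (hV2 : LocallyIntegrable (fun x => ‖V x‖ ^ 2) volume) (i j : Fin 3) :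
    LocallyIntegrable (fun y => V y i * V y j) volume := by
  have hmi : ∀ k, AEStronglyMeasurable (fun y => V y k) volume := fun k =>
    (EuclideanSpace.proj k : EuclideanSpace ℝ (Fin 3) →L[ℝ] ℝ).continuous.comp_aestronglyMeasurable hVm
  refine hV2.mono ((hmi i).mul (hmi j)) (Eventually.of_forall fun y => ?_)
  rw [norm_mul, Real.norm_of_nonneg (sq_nonneg _), sq]
  exact mul_le_mul (PiLp.norm_apply_le _ _) (PiLp.norm_apply_le _ _) (norm_nonneg _)
    (norm_nonneg _)

/-- **The mollified velocity is smooth** (`ρ ∈ C_c^∞`, `|V|² ∈ L¹_loc`). [folklore] -/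
theorem contDiff_convolution_velocity (hVm : AEStronglyMeasurable V volume)
    (hV2 : LocallyIntegrable (fun x => ‖V x‖ ^ 2) volume) (hρ : ContDiff ℝ ∞ ρ)
    (hρc : HasCompactSupport ρ) : ContDiff ℝ ∞ (ρ ⋆[lsmul ℝ ℝ, volume] V) :=
  hρc.contDiff_convolution_left _ hρ (locallyIntegrable_of_normSq hVm hV2)

/-- **The mollified flux is smooth** (entrywise). [folklore] -/
theorem contDiff_convolution_flux (hVm : AEStronglyMeasurable V volume)
    (hV2 : LocallyIntegrable (fun x => ‖V x‖ ^ 2) volume) (hρ : ContDiff ℝ ∞ ρ)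
    (hρc : HasCompactSupport ρ) (i j : Fin 3) :
    ContDiff ℝ ∞ (ρ ⋆[lsmul ℝ ℝ, volume] fun y => V y i * V y j) :=
  hρc.contDiff_convolution_left _ hρ (locallyIntegrable_apply_mul_apply hVm hV2 i j)

/-- **The mollified velocity is divergence free** when `V` is weakly divergence free off the
origin (the origin is removable for `L²_loc` fields in `ℝ³`, `isWeaklyDivFree_of_puncture`; then
`div (ρ ⋆ V) = -∫ ⟪V, ∇ρ(x − ·)⟫ = 0`, `divergence_convolution_eq_zero`). [folklore] -/
theorem divergence_convolution_velocity_eq_zero (hVm : AEStronglyMeasurable V volume)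
    (hV2 : LocallyIntegrable (fun x => ‖V x‖ ^ 2) volume)
    (hwdiv : ∀ θ : EuclideanSpace ℝ (Fin 3) → ℝ, FunctionSpaces.IsTestFunctionOn ⟨{x : EuclideanSpace ℝ (Fin 3) | x ≠ 0}, isOpen_ne⟩ θ →
      ∫ x, ⟪V x, gradient θ x⟫ = 0)
    (hρ : ContDiff ℝ ∞ ρ) (hρc : HasCompactSupport ρ) (x : EuclideanSpace ℝ (Fin 3)) :
    VectorCalculus.divergence (ρ ⋆[lsmul ℝ ℝ, volume] V) x = 0 :=
  divergence_convolution_eq_zero hρ hρc (locallyIntegrable_of_normSq hVm hV2)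
    (isWeaklyDivFree_of_puncture (by rw [finrank_euclideanSpace_fin]) hVm hV2 hwdiv) x

/-- **The defect of the mollified pair is positive semidefinite.** For a probability kernel
`ρ ∈ C_c`, `ρ ≥ 0`, `∫ ρ = 1`, and `|V|² ∈ L¹_loc`, at every point `x` the matrix
`(ρ ⋆ (VᵢVⱼ))(x) - (ρ ⋆ V)ᵢ(x) (ρ ⋆ V)ⱼ(x)` is positive semidefinite (Jensen: it is the covariance
matrix of `a ↦ V(x − a)` under `ρ(a) da`). Hence `(ρ ⋆ V, ρ ⋆ (V ⊗ V) - (ρ ⋆ V) ⊗ (ρ ⋆ V))` is an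
Euler–REYNOLDS subsolution wherever the linear identity holds. [folklore] -/
theorem posSemidef_mollified_defect (hVm : AEStronglyMeasurable V volume)
    (hV2 : LocallyIntegrable (fun x => ‖V x‖ ^ 2) volume) (hρ : Continuous ρ)
    (hρc : HasCompactSupport ρ) (hρ0 : ∀ a, 0 ≤ ρ a) (hρ1 : ∫ a, ρ a = 1) (x : EuclideanSpace ℝ (Fin 3)) :
    (Matrix.of fun i j : Fin 3 =>
      (∫ a, ρ a * (V (x - a) i * V (x - a) j)) -
        (∫ a, ρ a * V (x - a) i) * (∫ a, ρ a * V (x - a) j)).PosSemidef := by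
  set κ : Measure (EuclideanSpace ℝ (Fin 3)) := volume.withDensity fun a => ENNReal.ofReal (ρ a) with hκ
  have hmeas : Measurable fun a => ENNReal.ofReal (ρ a) :=
    ENNReal.measurable_ofReal.comp hρ.measurable
  have hfin : ∀ᵐ a ∂(volume : Measure (EuclideanSpace ℝ (Fin 3))), ENNReal.ofReal (ρ a) < ⊤ :=
    Eventually.of_forall fun _ => ENNReal.ofReal_lt_top
  haveI : IsProbabilityMeasure κ := by
    refine ⟨?_⟩
    rw [hκ, withDensity_apply _ MeasurableSet.univ, Measure.restrict_univ,
      ← ofReal_integral_eq_lintegral_ofReal (hρ.integrable_of_hasCompactSupport hρc)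
        (Eventually.of_forall hρ0), hρ1, ENNReal.ofReal_one]
  have hchg : ∀ f : EuclideanSpace ℝ (Fin 3) → ℝ, ∫ a, f a ∂κ = ∫ a, ρ a * f a := fun f => by
    rw [hκ, integral_withDensity_eq_integral_toReal_smul hmeas hfin]
    refine integral_congr_ae (Eventually.of_forall fun a => ?_)
    simp only [ENNReal.toReal_ofReal (hρ0 a), smul_eq_mul]
  have hm := aestronglyMeasurable_translate hVm x
  have hv : ∀ i, MemLp (fun a => V (x - a) i) 2 κ := by
    intro i
    have hmi : AEStronglyMeasurable (fun a => V (x - a) i) volume :=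
      (EuclideanSpace.proj i : EuclideanSpace ℝ (Fin 3) →L[ℝ] ℝ).continuous.comp_aestronglyMeasurable hm
    refine (memLp_two_iff_integrable_sq_norm
      (hmi.mono_ac (withDensity_absolutelyContinuous _ _))).2 ?_
    rw [integrable_withDensity_iff_integrable_smul' hmeas hfin]
    have h2 := integrable_mul_normSq_translate hV2 hρ hρc x
    refine h2.mono ?_ (Eventually.of_forall fun a => ?_)
    · exact (hmeas.ennreal_toReal.aestronglyMeasurable).smul (hmi.norm.pow 2)
    · rw [ENNReal.toReal_ofReal (hρ0 a), smul_eq_mul, norm_mul, norm_mul,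
        Real.norm_of_nonneg (sq_nonneg _), Real.norm_of_nonneg (sq_nonneg _), Real.norm_eq_abs]
      exact mul_le_mul_of_nonneg_left
        (pow_le_pow_left₀ (norm_nonneg _) (PiLp.norm_apply_le _ _) 2) (abs_nonneg _)
  have h := posSemidef_covariance (κ := κ) hv
  simp only [hchg] at h
  exact h

end Euclidean

end MollifiedEulerCone

end Literature.Analysis.FluidPDE

end
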